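import Summits.BirchSwinnertonDyer.BirchSwinnertonDyer.Theorems.EisensteinPrimesUnramifiedInflation
import Literature.NumberTheory.GaloisRepresentations.ContinuousCohomologyAdditiveTransport
import Literature.NumberTheory.GaloisRepresentations.GlobalTriangulineSpace
import HarnessLib

/-!
# Descending a discrete `Γ_K`-module to `G_{K,Σ}` from Néron–Ogg–Shafarevich-type inputs, and transporting descent / weak
# Leopoldt along equivariant isomorphisms (cell `bsd-eis`, seat `bsd-line-x1-p1-w4` gen 4; crux 2 `GoodLatticeBDPValue`
# stmt-BirchSwinnertonDyer-19032, line `halves`, V21 road S4 — glue file (G))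

HONEST FRAMING (cell `bsd-eis`, run/shared/lean/pub/bsd-eis/): Galois-module plumbing (no definition, no named fact, no `sorry`, no
`Theses` import); nothing about any curve is asserted; BSD / IMC2 / KY Thm. 1.4.1 are proved for NO curve. Helper
`--supports stmt-BirchSwinnertonDyer-19032`; closes no registered stub.

## What

The `hH2` producers of this seat (`…H2BookkeepingUnramifiedOutside` p647958, `…ZpExtension` p648541, `…CruxPlaces` p649361) want the
three `p`-divisible modules `A_k` DESCENDED to `G_{K,Σ}` (`ρ : ContinuousRep (GaloisGroupUnramifiedOutside K Σ) ℤ A`,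
`ρ(σ̄) m = σ • m`) together with weak Leopoldt for the descended representation. This file makes the descent step literal:

* §1 `smul_eq_of_mem_ramificationSubgroup` / `…_of_inertia`: if the inertia groups above every place outside `Σ` (all primes
  `𝔓 ∣ v`, resp. only the CHOSEN `GreenbergSelmer.inertia v`) act trivially on a discrete `Γ_K`-module `M` with continuous orbit
  maps, then the whole ramification subgroup `N_Σ` acts trivially (stabilisers are open subgroups ⊇ the conjugation-stable
  generating set); `exists_continuousRep_quot_of_inertia`: hence `M` descends (file (B2) `exists_continuousRep_quot`). Inputs of
  this shape are Silverman VII.4.1 for `E[p^∞]` at good `w ∤ p` (tree `smul_eq_of_mem_inertia_of_nsmul_eq_zero`) and `θ(I_w) = 1`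
  for a character module.
* §2 transport along an equivariant additive isomorphism `ψ : A' ≃+ A` from ANY descended model `ρ'` on `A'` (any coefficient
  ring): `smul_eq_of_descended_addEquiv` (`N_Σ` acts trivially on `A`), `exists_continuousRep_quot_of_addEquiv` (`A` descends),
  and `subsingleton_H_restrict_iff_of_addEquiv` (**weak Leopoldt over `Gal(K_Σ/L)` transfers** between the two models, any
  degree; tree `ContinuousRep.HAddEquivOfContinuousAddEquiv`), `subsingleton_H_restrict_iff_of_descended` (two descents on the
  SAME carrier, any two coefficient rings).

References: [SilvermanAEC2009] VII.4.1; [NeukirchSchmidtWingberg2008] VIII §3; [SerreGaloisCohomology1997] I §2.1–2.2;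
[Brown1982CohomologyGroups] III.1 Ex. 3.
-/

set_option autoImplicit false
set_option linter.dupNamespace false -- the summit namespace `…BirchSwinnertonDyer.BirchSwinnertonDyer.Theorems` (Sub = Summit, D-0017) trips it

noncomputable section

open scoped Pointwise

namespace Summit.BirchSwinnertonDyer.BirchSwinnertonDyer.Theorems.UnramifiedInflation

open CategoryTheory Function NumberField IsDedekindDomain Field Topology ContinuousCohomology
open Literature.NumberTheory.EllipticCurves Literature.NumberTheory.EllipticCurves.GreenbergSelmer
  Literature.NumberTheory.GaloisRepresentations Literature.NumberTheory.IwasawaTheory.Greenberg2006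

variable {K : Type} [Field K] [NumberField K] (S : Set (HeightOneSpectrum (𝓞 K)))

/-! ## §1 `N_Σ` acts trivially as soon as the inertia groups outside `Σ` do -/

section Inertia

variable {M : Type} [AddCommGroup M] [DistribMulAction (absoluteGaloisGroup K) M] [TopologicalSpace M] [DiscreteTopology M]

omit [NumberField K] in
/-- **If every inertia group above every place outside `Σ` fixes the discrete module `M` pointwise, so does the ramification
subgroup `N_Σ`** (continuous orbit maps): the stabiliser of `m` is an open, hence closed, subgroup of `Γ_K` containing the
conjugation-stable set `inertiaOutside K Σ`, hence its normal closure and the topological closure `N_Σ`.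
[cite: NeukirchSchmidtWingberg2008, VIII §3] [cite: SerreGaloisCohomology1997, I §2.1] -/
theorem smul_eq_of_mem_ramificationSubgroup (hcont : ∀ m : M, Continuous fun g : absoluteGaloisGroup K ↦ g • m)
    (hX : ∀ v ∉ S, ∀ 𝔓 ∈ v.primesAbove, ∀ σ ∈ 𝔓.inertia (absoluteGaloisGroup K), ∀ m : M, σ • m = m)
    {σ : absoluteGaloisGroup K} (hσ : σ ∈ ramificationSubgroup K S) (m : M) : σ • m = m := by
  let St : Subgroup (absoluteGaloisGroup K) := MulAction.stabilizer (absoluteGaloisGroup K) m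
  have hopen : IsOpen (St : Set (absoluteGaloisGroup K)) := by
    have h := (hcont m).isOpen_preimage {m} (isOpen_discrete _)
    exact h
  have hXW : inertiaOutside K S ⊆ St := fun x hx ↦ by
    rw [mem_inertiaOutside_iff] at hx
    obtain ⟨v, hv, 𝔓, h𝔓, hx⟩ := hx
    exact hX v hv 𝔓 h𝔓 x hx m
  have hconj : Group.conjugatesOfSet (inertiaOutside K S) ⊆ St := by
    intro y hy
    rw [Group.mem_conjugatesOfSet_iff] at hy
    obtain ⟨x, hx, hxy⟩ := hy
    obtain ⟨c, rfl⟩ := isConj_iff.1 hxy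
    exact hXW (conj_mem_inertiaOutside hx c)
  have hNW : Subgroup.normalClosure (inertiaOutside K S) ≤ St := by
    rw [Subgroup.normalClosure]
    exact (Subgroup.closure_le St).2 hconj
  have hle : ramificationSubgroup K S ≤ St :=
    Subgroup.topologicalClosure_minimal _ hNW (Subgroup.isClosed_of_isOpen _ hopen)
  exact hle hσ

/-- The same with only the CHOSEN inertia groups `GreenbergSelmer.inertia v` (`v ∉ Σ`) as input: every other inertia group
above `v` is a conjugate (`exists_conj_mem_inertia_of_mem_inertiaOutside`, transitivity of `Γ_K` on the primes above `v`).
[cite: NeukirchANT1999, Ch. I §9 Prop. (9.1)] [cite: NeukirchSchmidtWingberg2008, VIII §3] -/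
theorem smul_eq_of_mem_ramificationSubgroup_of_inertia (hcont : ∀ m : M, Continuous fun g : absoluteGaloisGroup K ↦ g • m)
    (hI : ∀ v ∉ S, ∀ x ∈ GreenbergSelmer.inertia v, ∀ m : M, x • m = m)
    {σ : absoluteGaloisGroup K} (hσ : σ ∈ ramificationSubgroup K S) (m : M) : σ • m = m := by
  refine smul_eq_of_mem_ramificationSubgroup S hcont (fun v hv 𝔓 h𝔓 x hx m ↦ ?_) hσ m
  obtain ⟨w, hw, ρ, hy⟩ := exists_conj_mem_inertia_of_mem_inertiaOutside
    (mem_inertiaOutside_iff.mpr ⟨v, hv, 𝔓, h𝔓, hx⟩)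
  have h := hI w hw _ hy (ρ⁻¹ • m)
  rw [mul_smul, mul_smul, smul_inv_smul] at h
  have h' := congrArg (fun n ↦ ρ • n) h
  simp only [smul_inv_smul] at h'
  exact h'

/-- **Descent from Néron–Ogg–Shafarevich-type input**: a discrete `Γ_K`-module with continuous orbit maps fixed pointwise by the
chosen inertia groups at all `v ∉ Σ` is a continuous representation of `G_{K,Σ}` inducing the given action.
[cite: NeukirchSchmidtWingberg2008, VIII §3] [cite: SerreGaloisCohomology1997, I §2.1] -/
theorem exists_continuousRep_quot_of_inertia (hcont : ∀ m : M, Continuous fun g : absoluteGaloisGroup K ↦ g • m)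
    (hI : ∀ v ∉ S, ∀ x ∈ GreenbergSelmer.inertia v, ∀ m : M, x • m = m) :
    ∃ ρ₀ : ContinuousRep (GaloisGroupUnramifiedOutside K S) ℤ M,
      ∀ (σ : absoluteGaloisGroup K) (m : M), ρ₀ (toUnramifiedQuot K S σ) m = σ • m :=
  exists_continuousRep_quot S hcont fun _ hσ m ↦ smul_eq_of_mem_ramificationSubgroup_of_inertia S hcont hI hσ m

end Inertia

/-! ## §2 Transport along equivariant additive isomorphisms -/

section Transport

variable {R : Type} [CommRing R] [TopologicalSpace R]
variable {A' : Type} [AddCommGroup A'] [Module R A'] [TopologicalSpace A'] [DiscreteTopology A']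
variable {A : Type} [AddCommGroup A] [DistribMulAction (absoluteGaloisGroup K) A] [TopologicalSpace A] [DiscreteTopology A]

omit [NumberField K] [TopologicalSpace R] [TopologicalSpace A'] [DiscreteTopology A'] [TopologicalSpace A] [DiscreteTopology A] in
/-- If SOME model `ρ'` of `A` (on a carrier `A'`, any coefficients) is a representation of `G_{K,Σ}` matching the `Γ_K`-action
through `ψ : A' ≃+ A`, then `N_Σ` acts trivially on `A`. [cite: NeukirchSchmidtWingberg2008, VIII §3] -/
theorem smul_eq_of_descended_addEquiv (ρ' : Representation R (GaloisGroupUnramifiedOutside K S) A') (ψ : A' ≃+ A)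
    (hψ : ∀ (σ : absoluteGaloisGroup K) (a : A'), ψ (ρ' (toUnramifiedQuot K S σ) a) = σ • ψ a)
    {σ : absoluteGaloisGroup K} (hσ : σ ∈ ramificationSubgroup K S) (m : A) : σ • m = m := by
  have h1 : toUnramifiedQuot K S σ = 1 := (QuotientGroup.eq_one_iff σ).mpr hσ
  have h := hψ σ (ψ.symm m)
  rw [h1, map_one, Module.End.one_apply, ψ.apply_symm_apply] at h
  exact h.symm

omit [NumberField K] [TopologicalSpace R] [TopologicalSpace A'] [DiscreteTopology A'] in
/-- … hence `A` itself descends to `G_{K,Σ}` (with `ℤ`-coefficients, on its own carrier), given continuous orbit maps.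
[cite: NeukirchSchmidtWingberg2008, VIII §3] [cite: SerreGaloisCohomology1997, I §2.1] -/
theorem exists_continuousRep_quot_of_addEquiv (hcont : ∀ m : A, Continuous fun g : absoluteGaloisGroup K ↦ g • m)
    (ρ' : Representation R (GaloisGroupUnramifiedOutside K S) A') (ψ : A' ≃+ A)
    (hψ : ∀ (σ : absoluteGaloisGroup K) (a : A'), ψ (ρ' (toUnramifiedQuot K S σ) a) = σ • ψ a) :
    ∃ ρ₀ : ContinuousRep (GaloisGroupUnramifiedOutside K S) ℤ A,
      ∀ (σ : absoluteGaloisGroup K) (m : A), ρ₀ (toUnramifiedQuot K S σ) m = σ • m :=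
  exists_continuousRep_quot S hcont fun _ hσ m ↦ smul_eq_of_descended_addEquiv S ρ' ψ hψ hσ m

variable [ContinuousSMul R A']

omit [NumberField K] in
/-- **Weak Leopoldt transfers between descended models.** For a descended model `ρ'` of `A` on a carrier `A'` (coefficients `R`)
and the descended representation `ρ` on `A` itself (coefficients `ℤ`), matched by `ψ : A' ≃+ A`, the cohomology groups of their
restrictions to `Gal(K_Σ/L) = galoisGroupAbove Σ H` are isomorphic in every degree; in particular
`Hⁿ(K_Σ/L, A') = 0 ↔ Hⁿ(K_Σ/L, A) = 0`. [cite: Brown1982CohomologyGroups, III.1 Example 3] [cite: SerreGaloisCohomology1997, I §2.2] -/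
theorem subsingleton_H_restrict_iff_of_addEquiv (ρ' : ContinuousRep (GaloisGroupUnramifiedOutside K S) R A')
    (ρ : ContinuousRep (GaloisGroupUnramifiedOutside K S) ℤ A) (ψ : A' ≃+ A)
    (hψ : ∀ (σ : absoluteGaloisGroup K) (a : A'), ψ (ρ' (toUnramifiedQuot K S σ) a) = σ • ψ a)
    (hρ : ∀ (σ : absoluteGaloisGroup K) (m : A), ρ (toUnramifiedQuot K S σ) m = σ • m)
    (H : Subgroup (absoluteGaloisGroup K)) (n : ℕ) :
    Subsingleton ((ρ'.restrict (galoisGroupAboveSubtype S H)).H n) ↔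
      Subsingleton ((ρ.restrict (galoisGroupAboveSubtype S H)).H n) := by
  let η : A' ≃ₜ+ A :=
    { ψ with continuous_toFun := continuous_of_discreteTopology, continuous_invFun := continuous_of_discreteTopology }
  have hη : ∀ (g : galoisGroupAbove S H) (x : A'),
      η (ρ'.restrict (galoisGroupAboveSubtype S H) g x) = ρ.restrict (galoisGroupAboveSubtype S H) g (η x) := by
    intro g x
    obtain ⟨σ, -, hσ⟩ := (mem_galoisGroupAbove_iff S H g).1 g.2
    change ψ (ρ' ((g : GaloisGroupUnramifiedOutside K S)) x) = ρ ((g : GaloisGroupUnramifiedOutside K S)) (ψ x)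
    rw [← hσ, hψ, hρ]
  let e := ContinuousRep.HAddEquivOfContinuousAddEquiv (ρ'.restrict (galoisGroupAboveSubtype S H))
    (ρ.restrict (galoisGroupAboveSubtype S H)) η hη n
  exact ⟨fun _ ↦ e.symm.toEquiv.subsingleton, fun _ ↦ e.toEquiv.subsingleton⟩

variable [Module R A] [ContinuousSMul R A]

omit [NumberField K] in
/-- Two descended representations on the SAME carrier (any two coefficient rings acting compatibly is not even needed: only the
group actions matter) have isomorphic cohomology over `Gal(K_Σ/L)`; with equal coefficients they are equal
(`eq_of_descended`). [cite: Brown1982CohomologyGroups, III.1 Example 3] -/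
theorem subsingleton_H_restrict_iff_of_descended (ρ' : ContinuousRep (GaloisGroupUnramifiedOutside K S) R A)
    (ρ : ContinuousRep (GaloisGroupUnramifiedOutside K S) ℤ A)
    (hρ' : ∀ (σ : absoluteGaloisGroup K) (m : A), ρ' (toUnramifiedQuot K S σ) m = σ • m)
    (hρ : ∀ (σ : absoluteGaloisGroup K) (m : A), ρ (toUnramifiedQuot K S σ) m = σ • m)
    (H : Subgroup (absoluteGaloisGroup K)) (n : ℕ) :
    Subsingleton ((ρ'.restrict (galoisGroupAboveSubtype S H)).H n) ↔
      Subsingleton ((ρ.restrict (galoisGroupAboveSubtype S H)).H n) :=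
  subsingleton_H_restrict_iff_of_addEquiv S ρ' ρ (AddEquiv.refl A) (fun σ a ↦ hρ' σ a) hρ H n

end Transport

end Summit.BirchSwinnertonDyer.BirchSwinnertonDyer.Theorems.UnramifiedInflation

end
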